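import Literature.Topology.FourManifolds.GompfTwistTransport
import Literature.Topology.FourManifolds.GompfProductTwist
import Literature.Topology.FourManifolds.GompfAxisTwist
import HarnessLib

/-!
# The Dehn-twisted straightening: the twisted product model is `X^{τ·σ}_{Δ B}`

Endgame algebra for the framed form of R. Gompf, *More Cappell–Shaneson spheres are standard*,
Algebr. Geom. Topol. 10 (2010), Theorem 2.1 (the named facts
`Literature.Topology.FourManifolds.gompf2010_framedTwist` /
`Literature.Topology.FourManifolds.gompf2010_framedTwistZero`), in the **straightened** setting in
which the fishtail neighbourhood is being constructed (`Straightening`, `Straightening.prodSphere`,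
`GompfFramedTwistTransport.lean`; the twist criterion
`nonempty_diffeomorph_prodSurgered_of_twistingDiffeo`, `GompfProductTwist.lean`).

The criterion turns a twisting diffeomorphism of `S.prodSphere ∖ Σ` (what the fishtail and
Lemma 2.2 deliver) into a diffeomorphism `prodSurgered ψ ε ≃ₘ prodSurgered (δ ∘ ψ) ε`,
`ψ = S.monodromy = B ∘ F₁`, `δ` Gompf's Dehn twist (`farDehn`). This file identifies the target with
the framed Cappell–Shaneson sphere it has to be, i.e. it proves Gompf's sentence (§4 ¶3) "Our
isotopy from `δᵏ` to `Δᵏ` changes the bundle monodromy to `B` (by changing the trivialization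
of the bundle `X^σ_A - X^σ_A|(t - ε, t + ε)`) but also changes the straightening to `τ·σ` (for the
linear `τ` as above). Thus, `X^{τ·σ}_B = X^σ_A`" in the tree's concrete terms:

* `Literature.Topology.FourManifolds.Straightening.dehnTwist` — for **any** straightening `S` of
  `B` with exactly linear germs and Gompf's far Dehn twist `δ = farDehn hτ hτ'`, a straightening
  `S.dehnTwist hτ hτ'` of `Δ B = gompfDelta ^ 1 * B` whose stages are
  `B⁻¹ ∘ D_{λ t}⁻¹ ∘ B ∘ F_{λ t}` (`D` the straight-line diffeotopy from `id` to `Δ ∘ δ⁻¹`,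
  `farDiffeotopy`; `λ = Real.smoothTransition`), with exactly linear germs
  `B⁻¹ Δ_{-λ t} B · G_{λ t}` and **monodromy `δ ∘ S.monodromy`**
  (`Straightening.dehnTwist_monodromy`);
* `Literature.Topology.FourManifolds.Straightening.dehnTwist_path_homotopic` — its framing path is
  homotopic rel end points to `S.reparam.path.deltaLeft 1` (Gompf's `τ·σ`: the path of `S`
  followed by the segment `B → Δ B`), by an explicit square homotopy through the family
  `K_{-u μ} · (G_μ B) · K_u`, `K_s = B⁻¹ Δ_s B` (a homotopy with one end point moving along the
  segment); and `Literature.Topology.FourManifolds.Straightening.reparam_path_homotopic`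
  (`S.reparam.path ≃ S.path`);
* `Literature.Topology.FourManifolds.nonempty_diffeomorph_prodSurgered_radius` — product-framed
  surgeries of the same straightened mapping torus with two admissible radii are diffeomorphic
  (fibrewise rescaling of the product tube, `CircleNbhd.nonempty_diffeomorph_surgered_of_eqOn_twist`);
* `Literature.Topology.FourManifolds.Straightening.nonempty_diffeomorph_prodSurgered_trans_farDehn`
  — **the twisted product model is the framed sphere of the row move**:
  `prodSurgered (δ ∘ S.monodromy) ε ≃ₘ gompfSphere (Δ B) (γ.deltaLeft 1)` for every admissible
  radius `ε` and every `γ` in the straightening class of `S` (transport theorem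
  `Straightening.nonempty_diffeomorph_gompfSphere_prodSphere_of_homotopic` for the twisted
  straightening, `W = gompf2010_straightening_invariance_holds`, and the two homotopies above);
* `Literature.Topology.FourManifolds.Straightening.nonempty_diffeomorph_gompfSphere_deltaLeft_one_of_prodTwistingDiffeo`
  — **the framed `k = 1` row move from a twisting diffeomorphism of the straightened product
  model**: if `S.prodSphere ∖ Σ` (`Σ = inr (farSupport τ × {1})`) carries a diffeomorphism
  twisting across the fibre sliver by `δ` on a neighbourhood `V` (hypotheses of
  `nonempty_diffeomorph_prodSurgered_of_twistingDiffeo`), then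
  `gompfSphere B γ ≃ₘ gompfSphere (gompfDelta ^ 1 * B) (γ.deltaLeft 1)` for every `γ ≃ S.path` —
  literally the hypothesis `h1` of `gompf2010_framedTwist_of_one` (`GompfFramedSpheresProofs.lean`)
  for the class of `S`; with both classes realised by straightenings
  (`exists_straightening_homotopic`, `GompfAxisTwist.lean`) this is the form in which the fishtail
  construction closes `gompf2010_framedTwist`.

Everything here is proved; no named facts are introduced.

## References

* R. E. Gompf, *More Cappell–Shaneson spheres are standard*, Algebr. Geom. Topol. 10 (2010)
  1665–1681: §3 ("`δ` is isotopic to the linear diffeomorphism `Δ`"), §4 Def. 4.1, ¶2 and ¶3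
  ("Our isotopy from `δᵏ` to `Δᵏ` … changes the straightening to `τ·σ` … Thus
  `X^{τ·σ}_B = X^σ_A`"), Thm 2.1 (proof, last paragraph). [GompfAGT2010]
* R. E. Gompf, A. I. Stipsicz, *4-Manifolds and Kirby Calculus*, GSM 20 (1999), §5.2 (surgery on
  a framed circle). [GompfStipsiczGSM1999]
-/

open scoped Manifold ContDiff Topology Real unitInterval
open Set Function Metric

noncomputable section

namespace Literature.Topology.FourManifolds

/-- Local notation: `𝔼 n` is the model Euclidean space `EuclideanSpace ℝ (Fin n)`. -/
local notation "𝔼 " n:arg => EuclideanSpace ℝ (Fin n)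

/-- Local notation: `𝕊 n` is the unit sphere in `EuclideanSpace ℝ (Fin (n + 1))`. -/
local notation "𝕊 " n:arg => (Metric.sphere (0 : EuclideanSpace ℝ (Fin (n + 1))) 1)

/-- Local notation: the model with corners `𝓣 = (𝓡 1).prod ((𝓡 1).prod (𝓡 1))` of `ThreeTorus`. -/
local notation "𝓣" =>
  (ModelWithCorners.prod (𝓡 1) (ModelWithCorners.prod (𝓡 1) (𝓡 1)))

attribute [local instance] fact_finrank_euclideanSpace_succ

/-! ### Coordinate bounds -/

section Bounds

/-- **Strict coordinate bound**: if `|M i j| ≤ K` (`K > 0`) and `|v j| < r` for all `j`, then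
`|(M v) i| < 3 K r`. [folklore] -/
theorem abs_mulVecE_lt_of_abs_lt {M : Matrix (Fin 3) (Fin 3) ℝ} {K r : ℝ} (hK : 0 < K)
    (hM : ∀ i j, |M i j| ≤ K) {v : 𝔼 3} (hv : ∀ j, |v j| < r) (i : Fin 3) :
    |mulVecE M v i| < 3 * K * r := by
  have hterm : ∀ j, |M i j * v j| ≤ K * |v j| := fun j ↦ by
    rw [abs_mul]
    exact mul_le_mul_of_nonneg_right (hM i j) (abs_nonneg _)
  have hlt : ∀ j, K * |v j| < K * r := fun j ↦ mul_lt_mul_of_pos_left (hv j) hK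
  rw [mulVecE_apply, Fin.sum_univ_three]
  have h0 := hterm 0; have h1 := hterm 1; have h2 := hterm 2
  have l0 := hlt 0; have l1 := hlt 1; have l2 := hlt 2
  calc |M i 0 * v 0 + M i 1 * v 1 + M i 2 * v 2|
      ≤ |M i 0 * v 0| + |M i 1 * v 1| + |M i 2 * v 2| := abs_add_three _ _ _
    _ < 3 * K * r := by linarith

/-- **A bound for the entries of the real matrix of `A ∈ SL(3, ℤ)`**: `1 + Σ |A i j|`. [folklore] -/
def matBound (A : Matrix.SpecialLinearGroup (Fin 3) ℤ) : ℝ := 1 + ∑ i, ∑ j, |slRealMatrix A i j|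

/-- `1 ≤ matBound A`. [folklore] -/
theorem one_le_matBound (A : Matrix.SpecialLinearGroup (Fin 3) ℤ) : 1 ≤ matBound A := by
  have : 0 ≤ ∑ i, ∑ j, |slRealMatrix A i j| :=
    Finset.sum_nonneg fun i _ ↦ Finset.sum_nonneg fun j _ ↦ abs_nonneg _
  unfold matBound; linarith

/-- `0 < matBound A`. [folklore] -/
theorem matBound_pos (A : Matrix.SpecialLinearGroup (Fin 3) ℤ) : 0 < matBound A :=
  one_pos.trans_le (one_le_matBound A)

/-- Every entry is bounded by `matBound`. [folklore] -/
theorem abs_slRealMatrix_le_matBound (A : Matrix.SpecialLinearGroup (Fin 3) ℤ) (i j : Fin 3) :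
    |slRealMatrix A i j| ≤ matBound A := by
  have h1 : |slRealMatrix A i j| ≤ ∑ j, |slRealMatrix A i j| :=
    Finset.single_le_sum (f := fun j ↦ |slRealMatrix A i j|) (fun _ _ ↦ abs_nonneg _) (Finset.mem_univ j)
  have h2 : ∑ j, |slRealMatrix A i j| ≤ ∑ i, ∑ j, |slRealMatrix A i j| :=
    Finset.single_le_sum (f := fun i ↦ ∑ j, |slRealMatrix A i j|)
      (fun _ _ ↦ Finset.sum_nonneg fun _ _ ↦ abs_nonneg _) (Finset.mem_univ i)
  unfold matBound; linarith

/-- The entries of `Δ_s`, `s ∈ [-1, 1]`, are bounded by `1`. [folklore] -/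
theorem abs_gompfDeltaReal_le_one {s : ℝ} (hs : |s| ≤ 1) (i j : Fin 3) : |gompfDeltaReal s i j| ≤ 1 := by
  fin_cases i <;> fin_cases j <;> simp [gompfDeltaReal, abs_neg, hs]

end Bounds

/-! ### Product-framed surgeries: equal monodromies, other radii -/

section Prod

variable {ψ ψ' : ThreeTorus ≃ₘ⟮𝓣, 𝓣⟯ ThreeTorus}

/-- Product-framed surgeries of (propositionally) equal monodromies are diffeomorphic. [folklore] -/
theorem nonempty_diffeomorph_prodSurgered_of_eq (h : ψ = ψ') {ε : ℝ} (hε : 0 < ε) (hεπ : ε ≤ π)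
    (hψ : ∀ v : 𝔼 3, ‖v‖ < ε → ψ (expT v) = expT v)
    (hψ' : ∀ v : 𝔼 3, ‖v‖ < ε → ψ' (expT v) = expT v) :
    Nonempty (prodSurgered ψ ε hε hεπ hψ ≃ₘ⟮𝓡 4, 𝓡 4⟯ prodSurgered ψ' ε hε hεπ hψ') := by
  subst h
  exact ⟨Diffeomorph.refl _ _ _⟩

/-- The product tube of radius `ε`, off `ptA`, through the shrinking map `univBall 0 ε`. [folklore] -/
theorem prodTube_apply_of_ne_univBall (ψ : ThreeTorus ≃ₘ⟮𝓣, 𝓣⟯ ThreeTorus) {ε : ℝ} (hε : 0 < ε)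
    (hεπ : ε ≤ π) (hψ : ∀ v : 𝔼 3, ‖v‖ < ε → ψ (expT v) = expT v) {u : 𝕊 1} (hu : u ≠ ptA)
    (w : 𝔼 3) :
    (prodTube ψ ε hε hεπ hψ).toFun (u, w) =
      (mtGlueData ψ).inl (expT (OpenPartialHomeomorph.univBall (0 : 𝔼 3) ε w), angAPt u) :=
  prodTube_apply_of_ne ψ ε hε hεπ hψ hu w

/-- The product tube of radius `ε`, off `ptB`, through the shrinking map `univBall 0 ε`. [folklore] -/
theorem prodTube_apply_of_ne_ptB_univBall (ψ : ThreeTorus ≃ₘ⟮𝓣, 𝓣⟯ ThreeTorus) {ε : ℝ} (hε : 0 < ε)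
    (hεπ : ε ≤ π) (hψ : ∀ v : 𝔼 3, ‖v‖ < ε → ψ (expT v) = expT v) {u : 𝕊 1} (hu : u ≠ ptB)
    (w : 𝔼 3) :
    (prodTube ψ ε hε hεπ hψ).toFun (u, w) =
      (mtGlueData ψ).inr (expT (OpenPartialHomeomorph.univBall (0 : 𝔼 3) ε w), angBPt u) :=
  prodTube_apply_of_ne_ptB ψ ε hε hεπ hψ hu w

/-- **Rescaling the product tube**: for `ε₁ ≤ ε₂` the product tube of radius `ε₁` is the product
tube of radius `ε₂` precomposed with the fibrewise rescaling by `ε₁ / ε₂` on the unit ball. [cite: GompfStipsiczGSM1999, §5.2] -/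
theorem prodTube_eq_prodTube_rescale (ψ : ThreeTorus ≃ₘ⟮𝓣, 𝓣⟯ ThreeTorus) {ε₁ ε₂ : ℝ}
    (hε₁ : 0 < ε₁) (hε₁π : ε₁ ≤ π) (hψ₁ : ∀ v : 𝔼 3, ‖v‖ < ε₁ → ψ (expT v) = expT v)
    (hε₂ : 0 < ε₂) (hε₂π : ε₂ ≤ π) (hψ₂ : ∀ v : 𝔼 3, ‖v‖ < ε₂ → ψ (expT v) = expT v)
    (hle : ε₁ ≤ ε₂) (u : 𝕊 1) {w : 𝔼 3} (hw : ‖w‖ ≤ 1) :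
    (prodTube ψ ε₁ hε₁ hε₁π hψ₁).toFun (u, w) =
      (prodTube ψ ε₂ hε₂ hε₂π hψ₂).toFun ((rescaleTube hε₂ (ε₁ / ε₂)).toDiffeomorph (u, w)) := by
  have hκ₀ : 0 < ε₁ / ε₂ := div_pos hε₁ hε₂
  have hκ1 : ε₁ / ε₂ ≤ 1 := (div_le_one hε₂).2 hle
  have hz : ‖(ε₁ / ε₂) • OpenPartialHomeomorph.univBall (0 : 𝔼 3) ε₂ w‖ < ε₂ := by
    rw [← univBall_eq_smul_univBall hε₁ hε₂ w]
    exact (norm_univBall_zero_lt hε₁ w).trans_le hle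
  rw [rescaleTube_apply_of_norm_le hε₂ hκ₀ hκ1 u hw]
  by_cases hu : u = ptA
  · subst hu
    rw [prodTube_apply_of_ne_ptB_univBall ψ hε₁ hε₁π hψ₁ ptA_ne_ptB,
      prodTube_apply_of_ne_ptB_univBall ψ hε₂ hε₂π hψ₂ ptA_ne_ptB,
      univBall_symm_apply_of_norm_lt hε₂ hz, ← univBall_eq_smul_univBall hε₁ hε₂ w]
  · rw [prodTube_apply_of_ne_univBall ψ hε₁ hε₁π hψ₁ hu, prodTube_apply_of_ne_univBall ψ hε₂ hε₂π hψ₂ hu,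
      univBall_symm_apply_of_norm_lt hε₂ hz, ← univBall_eq_smul_univBall hε₁ hε₂ w]

/-- **Product-framed surgeries with two admissible radii are diffeomorphic**: the two product
tubes agree on the unit ball bundle up to a compactly supported fibrewise rescaling, which does
not change the surgery (`CircleNbhd.nonempty_diffeomorph_surgered_of_eqOn_twist`). [cite: GompfStipsiczGSM1999, §5.2] -/
theorem nonempty_diffeomorph_prodSurgered_radius (ψ : ThreeTorus ≃ₘ⟮𝓣, 𝓣⟯ ThreeTorus) {ε₁ ε₂ : ℝ}
    (hε₁ : 0 < ε₁) (hε₁π : ε₁ ≤ π) (hψ₁ : ∀ v : 𝔼 3, ‖v‖ < ε₁ → ψ (expT v) = expT v)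
    (hε₂ : 0 < ε₂) (hε₂π : ε₂ ≤ π) (hψ₂ : ∀ v : 𝔼 3, ‖v‖ < ε₂ → ψ (expT v) = expT v) :
    Nonempty (prodSurgered ψ ε₁ hε₁ hε₁π hψ₁ ≃ₘ⟮𝓡 4, 𝓡 4⟯ prodSurgered ψ ε₂ hε₂ hε₂π hψ₂) := by
  -- the two section circles coincide
  have hsec : (prodPair ψ ε₂ hε₂ hε₂π hψ₂).secCircle = (prodPair ψ ε₁ hε₁ hε₁π hψ₁).secCircle :=
    TubeTwistPair.secCircle_eq _ _
  rcases le_total ε₁ ε₂ with hle | hle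
  · -- `ν₁ = ν₂ ∘ rescale (ε₁/ε₂)` on the unit ball
    have e1 : Nonempty (prodSurgered ψ ε₂ hε₂ hε₂π hψ₂ ≃ₘ⟮𝓡 4, 𝓡 4⟯
        ((prodTube ψ ε₁ hε₁ hε₁π hψ₁).copy hsec.symm).Surgered) :=
      (prodTube ψ ε₂ hε₂ hε₂π hψ₂).nonempty_diffeomorph_surgered_of_eqOn_twist
        (rescaleTube hε₂ (ε₁ / ε₂)) _ fun u w hw ↦ by
          rw [CircleNbhd.copy_toFun]
          exact prodTube_eq_prodTube_rescale ψ hε₁ hε₁π hψ₁ hε₂ hε₂π hψ₂ hle u hw.le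
    have e2 := (prodTube ψ ε₁ hε₁ hε₁π hψ₁).nonempty_diffeomorph_surgered_copy hsec.symm
    obtain ⟨e1⟩ := e1
    obtain ⟨e2⟩ := e2
    exact ⟨e2.trans (e1.symm)⟩
  · have hsec' := hsec.symm
    have e1 : Nonempty (prodSurgered ψ ε₁ hε₁ hε₁π hψ₁ ≃ₘ⟮𝓡 4, 𝓡 4⟯
        ((prodTube ψ ε₂ hε₂ hε₂π hψ₂).copy hsec).Surgered) :=
      (prodTube ψ ε₁ hε₁ hε₁π hψ₁).nonempty_diffeomorph_surgered_of_eqOn_twist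
        (rescaleTube hε₁ (ε₂ / ε₁)) _ fun u w hw ↦ by
          rw [CircleNbhd.copy_toFun]
          exact prodTube_eq_prodTube_rescale ψ hε₂ hε₂π hψ₂ hε₁ hε₁π hψ₁ hle u hw.le
    have e2 := (prodTube ψ ε₂ hε₂ hε₂π hψ₂).nonempty_diffeomorph_surgered_copy hsec
    obtain ⟨e1⟩ := e1
    obtain ⟨e2⟩ := e2
    exact ⟨e1.trans e2.symm⟩

end Prod

/-! ### The straight-line diffeotopy: inverse stages, reparametrisation -/

section Far

variable {τ : ℝ} (hτ : 0 < τ) (hτ' : τ < π / 2)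

/-- The inverse stages of the straight-line diffeotopy (definitional). [folklore] -/
theorem farDiffeotopy_invFun (t : ℝ) :
    (farDiffeotopy hτ hτ').invFun t =
      torusTwist fun w ↦ (circleMapOfLift (fun θ ↦ t * (θ - farLift τ θ)) w)⁻¹ :=
  rfl

/-- **The inverse stages are linear in exponential coordinates near the section circle**:
`D_t⁻¹ (expT w) = expT (Δ_{-t} w)` for `|w₁| < π - τ`. [cite: GompfAGT2010, §4 ¶3 (the isotopy can be taken to be linear … its derivative is the linear straightening of Δ^k)] -/
theorem farDiffeotopy_invFun_expT (t : ℝ) {w : 𝔼 3} (hw : |w 1| < π - τ) :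
    (farDiffeotopy hτ hτ').invFun t (expT w) = expT (mulVecE (gompfDeltaReal (-t)) w) := by
  have h1 : (mulVecE (gompfDeltaReal (-t)) w) 1 = w 1 := (mulVecE_gompfDeltaReal_apply (-t) w).2.1
  have h2 : (farDiffeotopy hτ hτ').toFun t (expT (mulVecE (gompfDeltaReal (-t)) w)) = expT w := by
    rw [farDiffeotopy_expT hτ hτ' t (by rw [h1]; exact hw), mulVecE_mulVecE, gompfDeltaReal_mul,
      add_neg_cancel, gompfDeltaReal_zero, mulVecE_one]
  rw [← h2, Diffeotopy.invFun_toFun]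

/-- The inverse stages fix the base point. [folklore] -/
theorem farDiffeotopy_invFun_one (t : ℝ) : (farDiffeotopy hτ hτ').invFun t 1 = 1 := by
  conv_lhs => rw [← farDiffeotopy_apply_one hτ hτ' t]
  exact Diffeotopy.invFun_toFun _ _ _

/-- **`Δ ∘ D_1⁻¹ = δ`**: the twist `Δ` after the inverse end stage of the straight-line diffeotopy
is the Dehn twist (all three are twists along the tori `{z₂ = const}`, which compose by
multiplying their circle maps). [cite: GompfAGT2010, §3 (δ is isotopic to Δ)] -/
theorem torusTwist_zpow_one_farDiffeotopy_invFun_one (z : ThreeTorus) :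
    torusTwist (fun w ↦ w ^ (1 : ℤ)) ((farDiffeotopy hτ hτ').invFun 1 z) = farDehn hτ hτ' z := by
  rw [farDiffeotopy_invFun, torusTwist_torusTwist, coe_farDehn]
  congr 1
  funext w
  rw [circleMapOfLift, circleMapOfLift, one_mul, Circle.exp_sub, zpow_one, Circle.exp_arg, inv_div,
    mul_div_cancel]

end Far


/-! ### Homotopy invariance of `deltaLeft` -/

section DeltaLeft

variable {A : Matrix.SpecialLinearGroup (Fin 3) ℤ}

/-- **`deltaLeft` respects straightening classes**: homotopic framing paths of `A` give homotopic
framing paths of `Δᵏ A` (both classes are `[γ] · [segment]` in the fundamental groupoid,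
`SmoothMatrixPath.mk_toPath_deltaLeft`). [cite: GompfAGT2010, §4 ¶2 (τ·σ by path concatenation)] -/
theorem SmoothMatrixPath.deltaLeft_homotopic {γ γ' : SmoothMatrixPath (slRealMatrix A)}
    (h : γ.toPath.Homotopic γ'.toPath) (k : ℤ) :
    (γ.deltaLeft k).toPath.Homotopic (γ'.deltaLeft k).toPath := by
  refine Path.Homotopic.Quotient.eq.1 ?_
  have h₁ := γ.mk_toPath_deltaLeft k rfl (det_segment_gompfDelta_zpow_mul A k)
  have h₂ := γ'.mk_toPath_deltaLeft k rfl (det_segment_gompfDelta_zpow_mul A k)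
  rw [SmoothMatrixPath.along_rfl] at h₁ h₂
  rw [h₁, h₂, Path.Homotopic.Quotient.eq.2 h]

end DeltaLeft

/-! ### Conjugated straight-line diffeotopy, profiles -/

section General

variable {B : Matrix.SpecialLinearGroup (Fin 3) ℤ} {τ : ℝ} (hτ : 0 < τ) (hτ' : τ < π / 2)

/-- **The conjugated inverse straight-line diffeotopy** `t ↦ B⁻¹ ∘ D_{λ t}⁻¹ ∘ B`. [cite: GompfAGT2010, §4 ¶3 (the isotopy from δ^k to Δ^k)] -/
def farConj (B : Matrix.SpecialLinearGroup (Fin 3) ℤ) (hτ : 0 < τ) (hτ' : τ < π / 2) :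
    Diffeotopy 𝓣 ThreeTorus :=
  (((farDiffeotopy hτ hτ').reparam Real.smoothTransition Real.smoothTransition.contDiff
    Real.smoothTransition.zero).inv).conj (torusDiffeomorph B)

/-- Stages of the conjugated diffeotopy (definitional). [folklore] -/
theorem farConj_toFun (t : ℝ) (x : ThreeTorus) :
    (farConj B hτ hτ').toFun t x = (torusDiffeomorph B).symm
      ((farDiffeotopy hτ hτ').invFun (Real.smoothTransition t) (torusDiffeomorph B x)) :=
  rfl

/-- Inverse stages of the conjugated diffeotopy (definitional). [folklore] -/
theorem farConj_invFun (t : ℝ) (y : ThreeTorus) :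
    (farConj B hτ hτ').invFun t y = (torusDiffeomorph B).symm
      ((farDiffeotopy hτ hτ').toFun (Real.smoothTransition t) (torusDiffeomorph B y)) :=
  rfl

/-- `B⁻¹ (expT w) = expT (B⁻¹ w)`. [folklore] -/
theorem torusDiffeomorph_symm_expT (B : Matrix.SpecialLinearGroup (Fin 3) ℤ) (w : 𝔼 3) :
    (torusDiffeomorph B).symm (expT w) = expT (mulVecE (slRealMatrix B⁻¹) w) :=
  torusMap_expT' B⁻¹ w

/-- `B (expT w) = expT (B w)`. [folklore] -/
theorem torusDiffeomorph_expT (B : Matrix.SpecialLinearGroup (Fin 3) ℤ) (w : 𝔼 3) :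
    torusDiffeomorph B (expT w) = expT (mulVecE (slRealMatrix B) w) :=
  torusMap_expT' B w

/-- `(Δ ^ 1)⁻¹` as a real matrix is `Δ_{-1}`. [folklore] -/
theorem slRealMatrix_gompfDelta_zpow_one_inv :
    slRealMatrix (gompfDelta ^ (1 : ℤ))⁻¹ = gompfDeltaReal (-1) := by
  have h := slRealMatrix_inv_mul (gompfDelta ^ (1 : ℤ))
  rw [slRealMatrix_gompfDelta_zpow_one] at h
  calc slRealMatrix (gompfDelta ^ (1 : ℤ))⁻¹
      = slRealMatrix (gompfDelta ^ (1 : ℤ))⁻¹ * (gompfDeltaReal 1 * gompfDeltaReal (-1)) := by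
        rw [gompfDeltaReal_mul, add_neg_cancel, gompfDeltaReal_zero, Matrix.mul_one]
    _ = gompfDeltaReal (-1) := by rw [← Matrix.mul_assoc, h, Matrix.one_mul]

/-- `(Δ B)⁻¹ = B⁻¹ Δ_{-1}` as real matrices. [folklore] -/
theorem slRealMatrix_deltaMul_inv (B : Matrix.SpecialLinearGroup (Fin 3) ℤ) :
    slRealMatrix (gompfDelta ^ (1 : ℤ) * B)⁻¹ = slRealMatrix B⁻¹ * gompfDeltaReal (-1) := by
  rw [mul_inv_rev, slRealMatrix_mul, slRealMatrix_gompfDelta_zpow_one_inv]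

/-- The profile `μ(θ) = λ(isotopyProfile(θ/2))` through which all paths here are read. [folklore] -/
def reparamProfile (θ : ℝ) : ℝ := Real.smoothTransition (isotopyProfile (θ / 2))

/-- `μ(0) = 1`. [folklore] -/
theorem reparamProfile_zero : reparamProfile 0 = 1 := by
  rw [reparamProfile, zero_div, isotopyProfile_of_le (by norm_num), Real.smoothTransition.one]

/-- `μ(θ) = 0` for `θ ≥ 1`. [folklore] -/
theorem reparamProfile_of_one_le {θ : ℝ} (h : 1 ≤ θ) : reparamProfile θ = 0 := by
  rw [reparamProfile, isotopyProfile_of_ge (by linarith), Real.smoothTransition.zero]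

/-- `μ` is continuous. [folklore] -/
theorem continuous_reparamProfile : Continuous reparamProfile :=
  Real.smoothTransition.continuous.comp
    (contDiff_isotopyProfile.continuous.comp (continuous_id.div_const _))

/-- Continuity of `p ↦ Δ_{f p}` for continuous `f`. [folklore] -/
theorem continuous_gompfDeltaReal_comp {X : Type*} [TopologicalSpace X] {f : X → ℝ} (hf : Continuous f) :
    Continuous fun x ↦ gompfDeltaReal (f x) := by
  refine continuous_matrix fun i j ↦ ?_
  fin_cases i <;> fin_cases j <;> simp [gompfDeltaReal] <;>
    first | exact continuous_const | exact hf | exact hf.neg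

end General

/-! ### The Dehn-twisted straightening -/

namespace Straightening

variable {B : Matrix.SpecialLinearGroup (Fin 3) ℤ} (S : Straightening B) {τ : ℝ} (hτ : 0 < τ)
  (hτ' : τ < π / 2)

/-- **A uniform bound for the linear parts on `[0, 1]`** (continuity on a compact interval). [folklore] -/
theorem exists_abs_G_le : ∃ K : ℝ, 1 ≤ K ∧ ∀ t ∈ Icc (0 : ℝ) 1, ∀ i j, |S.G t i j| ≤ K := by
  have h : ∀ i j : Fin 3, ∃ C, ∀ t ∈ Icc (0 : ℝ) 1, ‖S.G t i j‖ ≤ C := fun i j ↦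
    isCompact_Icc.exists_bound_of_continuousOn (S.contDiff_G i j).continuous.continuousOn
  choose C hC using h
  refine ⟨1 + ∑ i, ∑ j, |C i j|, by
    have : 0 ≤ ∑ i, ∑ j, |C i j| := Finset.sum_nonneg fun i _ ↦ Finset.sum_nonneg fun j _ ↦ abs_nonneg _
    linarith, fun t ht i j ↦ ?_⟩
  have h1 : |S.G t i j| ≤ |C i j| := ((Real.norm_eq_abs _).symm.le.trans (hC i j t ht)).trans (le_abs_self _)
  have h2 : |C i j| ≤ ∑ i, ∑ j, |C i j| :=
    (Finset.single_le_sum (f := fun j ↦ |C i j|) (fun _ _ ↦ abs_nonneg _) (Finset.mem_univ j)).trans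
      (Finset.single_le_sum (f := fun i ↦ ∑ j, |C i j|)
        (fun _ _ ↦ Finset.sum_nonneg fun _ _ ↦ abs_nonneg _) (Finset.mem_univ i))
  linarith

/-- The chosen bound for the linear parts on `[0, 1]`. [folklore] -/
def fwdBound : ℝ := S.exists_abs_G_le.choose

/-- `1 ≤ fwdBound`. [folklore] -/
theorem one_le_fwdBound : 1 ≤ S.fwdBound := S.exists_abs_G_le.choose_spec.1

/-- The linear parts on `[0, 1]` are entrywise bounded by `fwdBound`. [folklore] -/
theorem abs_G_le_fwdBound {t : ℝ} (ht : t ∈ Icc (0 : ℝ) 1) (i j : Fin 3) : |S.G t i j| ≤ S.fwdBound :=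
  S.exists_abs_G_le.choose_spec.2 t ht i j

/-- The constant `C = 27 · K_B · K_{B⁻¹} · K_G` controlling the cube of the twisted straightening. [folklore] -/
def twistConst : ℝ := 27 * matBound B * matBound B⁻¹ * S.fwdBound

/-- `C > 0`. [folklore] -/
theorem twistConst_pos : 0 < S.twistConst := by
  have h1 := matBound_pos B; have h2 := matBound_pos B⁻¹; have h3 := S.one_le_fwdBound
  unfold twistConst; positivity

/-- **The cube of the twisted straightening**: `R' = min (R, 1) / C`. [folklore] -/
def dehnRad : ℝ := min S.R 1 / S.twistConst

/-- `R' > 0`. [folklore] -/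
theorem dehnRad_pos : 0 < S.dehnRad := div_pos (lt_min S.R_pos one_pos) S.twistConst_pos

/-- `C R' ≤ 1`. [folklore] -/
theorem twistConst_mul_dehnRad_le_one : S.twistConst * S.dehnRad ≤ 1 := by
  rw [dehnRad, mul_div_cancel₀ _ S.twistConst_pos.ne']
  exact min_le_right _ _

/-- `C R' ≤ R`. [folklore] -/
theorem twistConst_mul_dehnRad_le_R : S.twistConst * S.dehnRad ≤ S.R := by
  rw [dehnRad, mul_div_cancel₀ _ S.twistConst_pos.ne']
  exact min_le_left _ _

/-- `R' ≤ R`. [folklore] -/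
theorem dehnRad_le_R : S.dehnRad ≤ S.R := by
  have h27 : (1 : ℝ) ≤ S.twistConst := by
    have h1 := one_le_matBound B; have h2 := one_le_matBound B⁻¹; have h3 := S.one_le_fwdBound
    unfold twistConst; nlinarith [mul_le_mul h1 h2 zero_le_one (zero_le_one.trans h1),
      mul_nonneg (zero_le_one.trans h1) (zero_le_one.trans h2)]
  have := S.twistConst_mul_dehnRad_le_R
  have hR := S.dehnRad_pos
  nlinarith

/-- `|(G_s v)_i| < 3 K_G R'` on the small cube, `s ∈ [0, 1]`. [folklore] -/
theorem abs_G_mulVecE_lt {s : ℝ} (hs : s ∈ Icc (0 : ℝ) 1) {v : 𝔼 3} (hv : ∀ j, |v j| < S.dehnRad)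
    (i : Fin 3) : |mulVecE (S.G s) v i| < 3 * S.fwdBound * S.dehnRad :=
  abs_mulVecE_lt_of_abs_lt (one_pos.trans_le S.one_le_fwdBound) (S.abs_G_le_fwdBound hs) hv i

/-- `|(B G_s v)_i| < π - τ` on the small cube (so that `D_t⁻¹` is linear there). [folklore] -/
theorem abs_B_G_mulVecE_lt (hτ' : τ < π / 2) {s : ℝ} (hs : s ∈ Icc (0 : ℝ) 1) {v : 𝔼 3}
    (hv : ∀ j, |v j| < S.dehnRad) (i : Fin 3) :
    |mulVecE (slRealMatrix B) (mulVecE (S.G s) v) i| < π - τ := by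
  have h1 : |mulVecE (slRealMatrix B) (mulVecE (S.G s) v) i| <
      3 * matBound B * (3 * S.fwdBound * S.dehnRad) :=
    abs_mulVecE_lt_of_abs_lt (matBound_pos B) (abs_slRealMatrix_le_matBound B) (S.abs_G_mulVecE_lt hs hv) i
  have h2 : 3 * matBound B * (3 * S.fwdBound * S.dehnRad) ≤ 1 := by
    have hc := S.twistConst_mul_dehnRad_le_one
    have hB' := one_le_matBound B⁻¹
    have hpos : 0 ≤ matBound B * S.fwdBound * S.dehnRad :=
      mul_nonneg (mul_nonneg (matBound_pos B).le (zero_le_one.trans S.one_le_fwdBound)) S.dehnRad_pos.le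
    unfold twistConst at hc
    nlinarith
  have h3 : (1 : ℝ) < π - τ := by linarith [Real.pi_gt_three]
  linarith

/-- `|(B v)_1| < π - τ` on the small cube (so that `D_t` is linear there). [folklore] -/
theorem abs_B_mulVecE_lt (hτ' : τ < π / 2) {v : 𝔼 3} (hv : ∀ j, |v j| < S.dehnRad) (i : Fin 3) :
    |mulVecE (slRealMatrix B) v i| < π - τ := by
  have h1 : |mulVecE (slRealMatrix B) v i| < 3 * matBound B * S.dehnRad :=
    abs_mulVecE_lt_of_abs_lt (matBound_pos B) (abs_slRealMatrix_le_matBound B) hv i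
  have h2 : 3 * matBound B * S.dehnRad ≤ 1 := by
    have hc := S.twistConst_mul_dehnRad_le_one
    have hB' := one_le_matBound B⁻¹
    have hG := S.one_le_fwdBound
    have hpos : 0 ≤ matBound B * S.dehnRad := mul_nonneg (matBound_pos B).le S.dehnRad_pos.le
    unfold twistConst at hc
    nlinarith [mul_le_mul hB' hG zero_le_one (zero_le_one.trans hB')]
  have h3 : (1 : ℝ) < π - τ := by linarith [Real.pi_gt_three]
  linarith

/-- `|(B⁻¹ Δ_s B v)_i| < R` on the small cube, `s ∈ [0, 1]` (so that `F_t⁻¹` is linear there). [folklore] -/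
theorem abs_conj_mulVecE_lt {s : ℝ} (hs : s ∈ Icc (0 : ℝ) 1) {v : 𝔼 3} (hv : ∀ j, |v j| < S.dehnRad)
    (i : Fin 3) :
    |mulVecE (slRealMatrix B⁻¹ * gompfDeltaReal s * slRealMatrix B) v i| < S.R := by
  have hs1 : |s| ≤ 1 := abs_le.2 ⟨by linarith [hs.1], hs.2⟩
  rw [← mulVecE_mulVecE, ← mulVecE_mulVecE]
  have h1 : ∀ i, |mulVecE (slRealMatrix B) v i| < 3 * matBound B * S.dehnRad :=
    abs_mulVecE_lt_of_abs_lt (matBound_pos B) (abs_slRealMatrix_le_matBound B) hv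
  have h2 : ∀ i, |mulVecE (gompfDeltaReal s) (mulVecE (slRealMatrix B) v) i| <
      3 * 1 * (3 * matBound B * S.dehnRad) :=
    abs_mulVecE_lt_of_abs_lt one_pos (abs_gompfDeltaReal_le_one hs1) h1
  have h3 : |mulVecE (slRealMatrix B⁻¹) (mulVecE (gompfDeltaReal s) (mulVecE (slRealMatrix B) v)) i| <
      3 * matBound B⁻¹ * (3 * 1 * (3 * matBound B * S.dehnRad)) :=
    abs_mulVecE_lt_of_abs_lt (matBound_pos B⁻¹) (abs_slRealMatrix_le_matBound B⁻¹) h2 i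
  have h4 : 3 * matBound B⁻¹ * (3 * 1 * (3 * matBound B * S.dehnRad)) ≤ S.R := by
    have hc := S.twistConst_mul_dehnRad_le_R
    have hG := S.one_le_fwdBound
    have hpos : 0 ≤ matBound B⁻¹ * matBound B * S.dehnRad :=
      mul_nonneg (mul_nonneg (matBound_pos B⁻¹).le (matBound_pos B).le) S.dehnRad_pos.le
    unfold twistConst at hc
    nlinarith
  linarith

/-- **The Dehn-twisted straightening of `Δ B`.** Given a straightening `S` of `B` with exactly
linear germs (diffeotopy `F`, germs `G`) and Gompf's far Dehn twist `δ = farDehn hτ hτ'` with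
its straight-line diffeotopy `D` from `id` to `Δ ∘ δ⁻¹` (linear germs `Δ_t`), the based
diffeotopy `t ↦ B⁻¹ ∘ D_{λ t}⁻¹ ∘ B ∘ F_{λ t}` of `T³` has exactly linear germs
`B⁻¹ Δ_{-λ t} B · G_{λ t}`, ends at `B⁻¹ Δ⁻¹ δ B F₁` with germ `B⁻¹ Δ_{-1} = (Δ B)⁻¹`, and so is a
straightening of `Δ B`; its monodromy is `δ ∘ B ∘ F₁ = δ ∘ S.monodromy` (`dehnTwist_monodromy`).
This is Gompf's "our isotopy from `δᵏ` to `Δᵏ` changes the bundle monodromy to `B` … but also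
changes the straightening to `τ·σ`" (§4 ¶3), as a construction on straightenings. [cite: GompfAGT2010, §4 ¶3 (the isotopy from δ^k to Δ^k changes the monodromy to B and the straightening to τ·σ)] -/
def dehnTwist : Straightening (gompfDelta ^ (1 : ℤ) * B) where
  D := S.reparam.D.trans (farConj B hτ hτ')
  based t := by
    rw [Diffeotopy.trans_toFun, comp_apply, S.reparam.based t, farConj_toFun, torusDiffeomorph_apply_one,
      farDiffeotopy_invFun_one]
    exact torusMap_apply_one _
  G t := slRealMatrix B⁻¹ * gompfDeltaReal (-Real.smoothTransition t) * slRealMatrix B *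
    S.G (Real.smoothTransition t)
  Ginv t := S.Ginv (Real.smoothTransition t) *
    (slRealMatrix B⁻¹ * gompfDeltaReal (Real.smoothTransition t) * slRealMatrix B)
  contDiff_G := SmoothMatrixPath.contDiff_mul_apply
    (SmoothMatrixPath.contDiff_mul_apply
      (SmoothMatrixPath.contDiff_mul_apply (fun _ _ ↦ contDiff_const)
        (contDiff_gompfDeltaReal_apply Real.smoothTransition.contDiff.neg))
      fun _ _ ↦ contDiff_const)
    fun i j ↦ (S.contDiff_G i j).comp Real.smoothTransition.contDiff
  contDiff_Ginv := SmoothMatrixPath.contDiff_mul_apply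
    (fun i j ↦ (S.contDiff_Ginv i j).comp Real.smoothTransition.contDiff)
    (SmoothMatrixPath.contDiff_mul_apply
      (SmoothMatrixPath.contDiff_mul_apply (fun _ _ ↦ contDiff_const)
        (contDiff_gompfDeltaReal_apply Real.smoothTransition.contDiff))
      fun _ _ ↦ contDiff_const)
  G_mul_Ginv t := by
    simp only [Matrix.mul_assoc]
    rw [← Matrix.mul_assoc (S.G _), S.G_mul_Ginv, Matrix.one_mul,
      ← Matrix.mul_assoc (slRealMatrix B) (slRealMatrix B⁻¹), slRealMatrix_mul_inv, Matrix.one_mul,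
      ← Matrix.mul_assoc (gompfDeltaReal _), gompfDeltaReal_mul, neg_add_cancel, gompfDeltaReal_zero,
      Matrix.one_mul, slRealMatrix_inv_mul]
  Ginv_mul_G t := by
    simp only [Matrix.mul_assoc]
    rw [← Matrix.mul_assoc (slRealMatrix B) (slRealMatrix B⁻¹), slRealMatrix_mul_inv, Matrix.one_mul,
      ← Matrix.mul_assoc (gompfDeltaReal _), gompfDeltaReal_mul, add_neg_cancel, gompfDeltaReal_zero,
      Matrix.one_mul, ← Matrix.mul_assoc (slRealMatrix B⁻¹), slRealMatrix_inv_mul, Matrix.one_mul,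
      S.Ginv_mul_G]
  G_zero := by
    rw [Real.smoothTransition.zero, neg_zero, gompfDeltaReal_zero, Matrix.mul_one, S.G_zero,
      Matrix.mul_one, slRealMatrix_inv_mul]
  G_one := by
    rw [Real.smoothTransition.one, S.G_one, Matrix.mul_assoc, slRealMatrix_mul_inv, Matrix.mul_one,
      slRealMatrix_deltaMul_inv]
  R := S.dehnRad
  R_pos := S.dehnRad_pos
  toFun_expT t v hv := by
    have hv' : ∀ i, |v i| < S.reparam.R := fun i ↦ (hv i).trans_le S.dehnRad_le_R
    have hs : Real.smoothTransition t ∈ Icc (0 : ℝ) 1 :=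
      ⟨Real.smoothTransition.nonneg t, Real.smoothTransition.le_one t⟩
    rw [Diffeotopy.trans_toFun, comp_apply, S.reparam.toFun_expT t v hv', reparam_G, farConj_toFun,
      torusDiffeomorph_expT, farDiffeotopy_invFun_expT hτ hτ' _ (S.abs_B_G_mulVecE_lt hτ' hs hv 1),
      torusDiffeomorph_symm_expT, mulVecE_mulVecE, mulVecE_mulVecE, mulVecE_mulVecE]
  invFun_expT t v hv := by
    have hs : Real.smoothTransition t ∈ Icc (0 : ℝ) 1 :=
      ⟨Real.smoothTransition.nonneg t, Real.smoothTransition.le_one t⟩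
    have hw : ∀ i, |mulVecE (slRealMatrix B⁻¹ * gompfDeltaReal (Real.smoothTransition t) * slRealMatrix B) v i| <
        S.reparam.R := fun i ↦ S.abs_conj_mulVecE_lt hs hv i
    rw [Diffeotopy.trans_invFun, comp_apply, farConj_invFun, torusDiffeomorph_expT,
      farDiffeotopy_expT hτ hτ' _ (S.abs_B_mulVecE_lt hτ' hv 1), torusDiffeomorph_symm_expT,
      mulVecE_mulVecE, mulVecE_mulVecE, S.reparam.invFun_expT t _ hw, reparam_Ginv, mulVecE_mulVecE]

/-- Linear parts of the twisted straightening (definitional). [folklore] -/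
@[simp] theorem dehnTwist_G (t : ℝ) :
    (S.dehnTwist hτ hτ').G t = slRealMatrix B⁻¹ * gompfDeltaReal (-Real.smoothTransition t) *
      slRealMatrix B * S.G (Real.smoothTransition t) := rfl

/-- The reparametrised straightening has the same monodromy. [folklore] -/
theorem reparam_monodromy : S.reparam.monodromy = S.monodromy := by
  refine Diffeomorph.ext fun x ↦ ?_
  show torusDiffeomorph B (S.D.toFun (Real.smoothTransition 1) x) = torusDiffeomorph B (S.D.toFun 1 x)
  rw [Real.smoothTransition.one]

/-- **The monodromy of the twisted straightening is `δ ∘ S.monodromy`**: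
`(Δ B) ∘ B⁻¹ ∘ D_1⁻¹ ∘ B ∘ F₁ = Δ ∘ D_1⁻¹ ∘ (B ∘ F₁) = δ ∘ ψ`. [cite: GompfAGT2010, §4 ¶3 (the isotopy from δ^k to Δ^k changes the monodromy to B and the straightening to τ·σ)] -/
theorem dehnTwist_monodromy :
    (S.dehnTwist hτ hτ').monodromy = S.monodromy.trans (farDehn hτ hτ') := by
  refine Diffeomorph.ext fun x ↦ ?_
  have h1 : S.reparam.D.toFun 1 x = S.D.toFun 1 x := by
    show S.D.toFun (Real.smoothTransition 1) x = _
    rw [Real.smoothTransition.one]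
  show torusDiffeomorph (gompfDelta ^ (1 : ℤ) * B) ((S.reparam.D.trans (farConj B hτ hτ')).toFun 1 x) =
    farDehn hτ hτ' (torusDiffeomorph B (S.D.toFun 1 x))
  rw [Diffeotopy.trans_toFun, comp_apply, farConj_toFun, Real.smoothTransition.one, torusDiffeomorph_mul,
    Diffeomorph.coe_trans, comp_apply, Diffeomorph.apply_symm_apply, coe_torusDiffeomorph_gompfDelta_zpow,
    torusTwist_zpow_one_farDiffeotopy_invFun_one, h1]

/-! ### Determinants of the linear parts -/

/-- The linear parts are invertible. [folklore] -/
theorem det_G_ne_zero (s : ℝ) : (S.G s).det ≠ 0 := fun h ↦ by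
  have := congrArg Matrix.det (S.G_mul_Ginv s)
  rw [Matrix.det_mul, h, zero_mul, Matrix.det_one] at this
  exact zero_ne_one this

/-- The determinant of the linear parts is continuous in `t`. [folklore] -/
theorem continuous_det_G : Continuous fun s ↦ (S.G s).det :=
  (continuous_matrix fun i j ↦ (S.contDiff_G i j).continuous).matrix_det

/-- **The linear parts have positive determinant** (never zero, `= 1` at `t = 0`). [folklore] -/
theorem det_G_pos (s : ℝ) : 0 < (S.G s).det := by
  have h0 : (S.G 0).det = 1 := by rw [S.G_zero, Matrix.det_one]
  rcases le_total 0 s with hs | hs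
  · exact forall_pos_of_forall_ne_zero (a := 0) (b := s) S.continuous_det_G.continuousOn
      (by rw [h0]; exact one_pos) (fun t _ ↦ S.det_G_ne_zero t) s ⟨hs, le_rfl⟩
  · have h := forall_pos_of_forall_ne_zero (f := fun t ↦ (S.G (-t)).det) (a := 0) (b := -s)
      (S.continuous_det_G.comp continuous_neg).continuousOn
      (by simp only [neg_zero]; rw [h0]; exact one_pos) (fun t _ ↦ S.det_G_ne_zero (-t)) (-s)
      ⟨by linarith, le_rfl⟩
    simpa using h

/-! ### `S.reparam.path ≃ S.path` -/

/-- **The framing path of the reparametrised straightening is homotopic rel end points to the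
framing path of `S`**: interpolate the time parameter linearly between `λ ∘ isotopyProfile` and
`isotopyProfile`. [cite: GompfAGT2010, Def. 4.1 and §4 ¶2 (X^σ depends only on the straightening class σ)] -/
theorem reparam_path_homotopic : S.reparam.path.toPath.Homotopic S.path.toPath := by
  let c : ℝ → ℝ → ℝ := fun r θ ↦
    (1 - r) * Real.smoothTransition (isotopyProfile (θ / 2)) + r * isotopyProfile (θ / 2)
  have hdet : ∀ r θ, 0 < (S.G (c r θ) * slRealMatrix B).det := fun r θ ↦ by
    rw [Matrix.det_mul, det_slRealMatrix, mul_one]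
    exact S.det_G_pos _
  have hip : Continuous fun θ : ℝ ↦ isotopyProfile (θ / 2) :=
    contDiff_isotopyProfile.continuous.comp (continuous_id.div_const _)
  have hr : Continuous fun p : I × I ↦ ((p.1 : ℝ)) := continuous_subtype_val.comp continuous_fst
  have hθ : Continuous fun p : I × I ↦ ((p.2 : ℝ)) := continuous_subtype_val.comp continuous_snd
  have hipθ : Continuous fun p : I × I ↦ isotopyProfile ((p.2 : ℝ) / 2) := hip.comp hθ
  have hc : Continuous fun p : I × I ↦ c p.1 p.2 :=
    ((continuous_const.sub hr).mul (Real.smoothTransition.continuous.comp hipθ)).add (hr.mul hipθ)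
  have hcont : Continuous fun p : I × I ↦
      (⟨S.G (c p.1 p.2) * slRealMatrix B, hdet _ _⟩ : PosDetMatrix 3) := by
    refine Continuous.subtype_mk (Continuous.matrix_mul ?_ continuous_const) _
    exact continuous_matrix fun i j ↦ (S.contDiff_G i j).continuous.comp hc
  refine ⟨{ toFun := fun p ↦ ⟨S.G (c p.1 p.2) * slRealMatrix B, hdet _ _⟩
            continuous_toFun := hcont
            map_zero_left := fun θ ↦ Subtype.ext ?_
            map_one_left := fun θ ↦ Subtype.ext ?_
            prop' := fun r θ hθ ↦ Subtype.ext ?_ }⟩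
  · show S.G (c 0 θ) * slRealMatrix B = S.reparam.path.toFun θ
    rw [reparam_path_toFun]
    simp only [c, sub_zero, one_mul, zero_mul, add_zero]
  · show S.G (c 1 θ) * slRealMatrix B = S.path.toFun θ
    simp only [c, sub_self, zero_mul, one_mul, zero_add]
    rfl
  · show S.G (c r θ) * slRealMatrix B = S.reparam.path.toFun θ
    simp only [Set.mem_insert_iff, Set.mem_singleton_iff] at hθ
    rcases hθ with rfl | rfl
    · simp only [Set.Icc.coe_zero]
      rw [S.reparam.path.eq_one 0 le_rfl]
      simp only [c, zero_div, isotopyProfile_of_le (show (0 : ℝ) ≤ 1 / 4 by norm_num),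
        Real.smoothTransition.one, mul_one, sub_add_cancel, S.G_one, slRealMatrix_inv_mul]
    · simp only [Set.Icc.coe_one]
      rw [S.reparam.path.eq_self 1 le_rfl]
      simp only [c, isotopyProfile_of_ge (show (1 : ℝ) / 2 ≤ 1 / 2 by norm_num),
        Real.smoothTransition.zero, mul_zero, add_zero, S.G_zero, Matrix.one_mul]

/-! ### The framing path of the twisted straightening is `τ·σ` -/

/-- **Values of the framing path of the twisted straightening**:
`B⁻¹ Δ_{-μ} B · G_μ · Δ_1 B`. [folklore] -/
theorem dehnTwist_path_toFun (θ : ℝ) :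
    (S.dehnTwist hτ hτ').path.toFun θ = slRealMatrix B⁻¹ * gompfDeltaReal (-reparamProfile θ) * slRealMatrix B *
      S.G (reparamProfile θ) * (gompfDeltaReal 1 * slRealMatrix B) := by
  show (S.dehnTwist hτ hτ').G (isotopyProfile (θ / 2)) * slRealMatrix (gompfDelta ^ (1 : ℤ) * B) = _
  rw [slRealMatrix_mul, slRealMatrix_gompfDelta_zpow_one]
  rfl

/-- Values of `S.reparam.path.deltaLeft 1`: `Δ_{λ(2θ-1)} · G_{μ(2θ)} B`. [folklore] -/
theorem reparam_path_deltaLeft_one_toFun (θ : ℝ) :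
    (S.reparam.path.deltaLeft 1).toFun θ =
      gompfDeltaReal (Real.smoothTransition (2 * θ - 1)) * (S.G (reparamProfile (2 * θ)) * slRealMatrix B) := by
  rw [deltaLeft_one_toFun, reparam_path_toFun]
  rfl

/-- **The framing path of the twisted straightening is Gompf's `τ·σ`**: it is homotopic rel end
points to `S.reparam.path.deltaLeft 1` (the path of `S` followed by the segment `B → Δ B`).
Writing `K_s = B⁻¹ Δ_s B` and `P = S.reparam.path`, the twisted path is `K_{-μ} P K_1`; the family
`(r, θ) ↦ K_{-u μ(θ')} P(θ') K_u` with `θ' = (1 + r) θ`, `u = (1 - r) + r λ(2θ - 1)` is a homotopy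
rel end points to `Δ_{λ(2θ-1)} P(2θ) = P.deltaLeft 1` through matrices of positive determinant. [cite: GompfAGT2010, §4 ¶3 (the isotopy changes the straightening to τ·σ)] -/
theorem dehnTwist_path_homotopic :
    (S.dehnTwist hτ hτ').path.toPath.Homotopic (S.reparam.path.deltaLeft 1).toPath := by
  let θ' : ℝ → ℝ → ℝ := fun r θ ↦ (1 + r) * θ
  let u : ℝ → ℝ → ℝ := fun r θ ↦ (1 - r) + r * Real.smoothTransition (2 * θ - 1)
  let H : ℝ → ℝ → Matrix (Fin 3) (Fin 3) ℝ := fun r θ ↦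
    slRealMatrix B⁻¹ * gompfDeltaReal (-(u r θ * reparamProfile (θ' r θ))) * slRealMatrix B * S.G (reparamProfile (θ' r θ)) *
      (gompfDeltaReal (u r θ) * slRealMatrix B)
  have hdet : ∀ r θ, 0 < (H r θ).det := fun r θ ↦ by
    simp only [H, Matrix.det_mul, det_slRealMatrix, det_gompfDeltaReal, mul_one, one_mul]
    exact S.det_G_pos _
  have hθ' : Continuous fun p : I × I ↦ θ' p.1 p.2 := by simp only [θ']; fun_prop
  have hu : Continuous fun p : I × I ↦ u p.1 p.2 := by
    have h2 : Continuous Real.smoothTransition := Real.smoothTransition.continuous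
    simp only [u]; fun_prop
  have hmu : Continuous fun p : I × I ↦ reparamProfile (θ' p.1 p.2) := continuous_reparamProfile.comp hθ'
  have hcont : Continuous fun p : I × I ↦ (⟨H p.1 p.2, hdet _ _⟩ : PosDetMatrix 3) := by
    refine Continuous.subtype_mk ?_ _
    simp only [H]
    refine Continuous.matrix_mul (Continuous.matrix_mul (Continuous.matrix_mul
      (Continuous.matrix_mul continuous_const (continuous_gompfDeltaReal_comp (hu.mul hmu).neg))
      continuous_const) (continuous_matrix fun i j ↦ (S.contDiff_G i j).continuous.comp hmu))
      (Continuous.matrix_mul (continuous_gompfDeltaReal_comp hu) continuous_const)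
  refine ⟨{ toFun := fun p ↦ ⟨H p.1 p.2, hdet _ _⟩
            continuous_toFun := hcont
            map_zero_left := fun θ ↦ Subtype.ext ?_
            map_one_left := fun θ ↦ Subtype.ext ?_
            prop' := fun r θ hθ ↦ Subtype.ext ?_ }⟩
  · -- `r = 0`: the twisted path
    show H 0 θ = (S.dehnTwist hτ hτ').path.toFun θ
    rw [dehnTwist_path_toFun]
    simp only [H, u, θ', sub_zero, zero_mul, add_zero, one_mul]
  · -- `r = 1`: `τ·σ`
    show H 1 θ = (S.reparam.path.deltaLeft 1).toFun θ
    rw [reparam_path_deltaLeft_one_toFun]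
    simp only [H, u, θ', sub_self, one_mul, zero_add, one_add_one_eq_two]
    rcases le_total (θ : ℝ) (1 / 2) with h | h
    · rw [Real.smoothTransition.zero_of_nonpos (by linarith), zero_mul, neg_zero, gompfDeltaReal_zero]
      simp only [Matrix.mul_one, Matrix.one_mul, slRealMatrix_inv_mul]
    · rw [reparamProfile_of_one_le (by linarith), mul_zero, neg_zero, gompfDeltaReal_zero, S.G_zero]
      simp only [Matrix.mul_one, Matrix.one_mul, slRealMatrix_inv_mul]
  · -- end points
    show H r θ = (S.dehnTwist hτ hτ').path.toFun θ
    simp only [Set.mem_insert_iff, Set.mem_singleton_iff] at hθ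
    rcases hθ with rfl | rfl
    · simp only [Set.Icc.coe_zero]
      rw [(S.dehnTwist hτ hτ').path.eq_one 0 le_rfl]
      simp only [H, u, θ', mul_zero, reparamProfile_zero, mul_one, S.G_one]
      rw [Real.smoothTransition.zero_of_nonpos (by norm_num), mul_zero, add_zero]
      simp only [Matrix.mul_assoc]
      rw [← Matrix.mul_assoc (slRealMatrix B) (slRealMatrix B⁻¹), slRealMatrix_mul_inv, Matrix.one_mul,
        ← Matrix.mul_assoc (gompfDeltaReal _), gompfDeltaReal_mul, neg_add_cancel, gompfDeltaReal_zero,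
        Matrix.one_mul, slRealMatrix_inv_mul]
    · simp only [Set.Icc.coe_one]
      rw [(S.dehnTwist hτ hτ').path.eq_self 1 le_rfl, slRealMatrix_mul, slRealMatrix_gompfDelta_zpow_one]
      have h1 : reparamProfile (θ' r 1) = 0 :=
        reparamProfile_of_one_le (by simp only [θ', mul_one]; linarith [unitInterval.nonneg r])
      have h2 : u r 1 = 1 := by
        simp only [u]
        rw [show (2 : ℝ) * 1 - 1 = 1 by norm_num, Real.smoothTransition.one_of_one_le le_rfl]
        ring
      simp only [H, h1, h2, mul_zero, neg_zero, gompfDeltaReal_zero, Matrix.mul_one, S.G_zero,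
        Matrix.one_mul, slRealMatrix_inv_mul]

/-! ### The twisted product model is the framed sphere of the row move -/

/-- **The twisted product model is `X^{τ·σ}_{Δ B}`.** For any straightening `S` of `B` with
exactly linear germs, Gompf's far Dehn twist `δ`, any admissible radius `ε` and any framing path
`γ` in the class of `S`:
`prodSurgered (δ ∘ S.monodromy) ε ≃ₘ gompfSphere (Δ B) (γ.deltaLeft 1)` — change the radius to
that of the twisted straightening (`nonempty_diffeomorph_prodSurgered_radius`), identify the
monodromies (`dehnTwist_monodromy`), apply the transport theorem to the twisted straightening
(`Straightening.nonempty_diffeomorph_gompfSphere_prodSphere_of_homotopic`) with the class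
`[γ.deltaLeft 1] = [S.reparam.path.deltaLeft 1] = [(S.dehnTwist).path]`
(`deltaLeft_homotopic`, `reparam_path_homotopic`, `dehnTwist_path_homotopic`). Gompf §4 ¶3:
"Thus, `X^{τ·σ}_B = X^σ_A`". [cite: GompfAGT2010, §4 ¶3 (X^{τ·σ}_B = X^σ_A for B = Δ^k A)] -/
theorem nonempty_diffeomorph_prodSurgered_trans_farDehn {ε : ℝ} (hε : 0 < ε) (hεπ : ε ≤ π)
    (hψε : ∀ v : 𝔼 3, ‖v‖ < ε → (S.monodromy.trans (farDehn hτ hτ')) (expT v) = expT v)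
    (γ : SmoothMatrixPath (slRealMatrix B)) (hγ : γ.toPath.Homotopic S.path.toPath) :
    Nonempty (prodSurgered (S.monodromy.trans (farDehn hτ hτ')) ε hε hεπ hψε ≃ₘ⟮𝓡 4, 𝓡 4⟯
      gompfSphere (gompfDelta ^ (1 : ℤ) * B) (γ.deltaLeft 1)) := by
  have hmono := S.dehnTwist_monodromy hτ hτ'
  have hψ' : ∀ v : 𝔼 3, ‖v‖ < (S.dehnTwist hτ hτ').prodRad →
      (S.monodromy.trans (farDehn hτ hτ')) (expT v) = expT v := fun v hv ↦ by
    rw [← hmono]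
    exact (S.dehnTwist hτ hτ').monodromy_expT_of_norm_lt v hv
  have e1 := nonempty_diffeomorph_prodSurgered_radius (S.monodromy.trans (farDehn hτ hτ')) hε hεπ hψε
    (S.dehnTwist hτ hτ').prodRad_pos (S.dehnTwist hτ hτ').prodRad_le_pi hψ'
  have e2 := nonempty_diffeomorph_prodSurgered_of_eq hmono.symm (S.dehnTwist hτ hτ').prodRad_pos
    (S.dehnTwist hτ hτ').prodRad_le_pi hψ' (S.dehnTwist hτ hτ').monodromy_expT_of_norm_lt
  have hclass : (γ.deltaLeft 1).toPath.Homotopic (S.dehnTwist hτ hτ').path.toPath :=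
    (SmoothMatrixPath.deltaLeft_homotopic (hγ.trans S.reparam_path_homotopic.symm) 1).trans
      (S.dehnTwist_path_homotopic hτ hτ').symm
  have e3 := (S.dehnTwist hτ hτ').nonempty_diffeomorph_gompfSphere_prodSphere_of_homotopic
    (γ.deltaLeft 1) hclass
  exact nonempty_diffeomorph_trans (nonempty_diffeomorph_trans e1 e2) (e3.map Diffeomorph.symm)

/-- The product radius is below `π - τ` (so the tube ball misses the support of `δ`). [folklore] -/
theorem prodRad_lt_pi_sub (hτ' : τ < π / 2) : S.prodRad < π - τ := by
  have h1 : S.prodRad ≤ twistRadius B S.path := by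
    have ha := straightenScale'_le_one B
    have hb := S.scale_le_one
    have hc := (twistRadius_pos B S.path).le
    have hd := S.scale_pos.le
    have := straightenScale'_pos B
    calc S.prodRad = straightenScale' B * (S.scale * twistRadius B S.path) := rfl
      _ ≤ 1 * (1 * twistRadius B S.path) := by gcongr
      _ = twistRadius B S.path := by ring
  have h2 := twistRadius_lt_pi_div_two B S.path
  linarith

/-- **The framed `k = 1` row move from a twisting diffeomorphism of the straightened product
model.** Let `S` be a straightening of `B` with exactly linear germs, `δ = farDehn hτ hτ'` Gompf's
far Dehn twist (supported in `farSupport τ`, away from the product tube), `V` an open set of the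
second cylinder containing the fibre sliver `farSupport τ × {1}`, missing the fibre through `1` and
stable under the sliver twist of `δ⁻¹`. If the straightened product model minus the sliver,
`S.prodSphere ∖ Σ`, carries a diffeomorphism `G` twisting across the sliver by `δ` on `V` — which
is what Gompf's fishtail neighbourhood and Lemma 2.2 provide —, then
`gompfSphere B γ ≃ₘ gompfSphere (Δ B) (γ.deltaLeft 1)` for every framing path `γ` in the class of
`S`: the hypothesis `h1` of `gompf2010_framedTwist_of_one` for that class. Chain:
`gompfSphere B γ ≅ S.prodSphere` (transport) `≅ prodSurgered (δ ∘ S.monodromy) ε₁` (twist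
criterion `nonempty_diffeomorph_prodSurgered_of_twistingDiffeo`) `≅ gompfSphere (Δ B) (γ.deltaLeft 1)`
(`nonempty_diffeomorph_prodSurgered_trans_farDehn`). [cite: GompfAGT2010, Thm 2.1 (proof, last paragraph) and §4 ¶3 (X^{τ·σ}_B = X^σ_A)] -/
theorem nonempty_diffeomorph_gompfSphere_deltaLeft_one_of_prodTwistingDiffeo
    (γ : SmoothMatrixPath (slRealMatrix B)) (hγ : γ.toPath.Homotopic S.path.toPath)
    (V : TopologicalSpace.Opens (ThreeTorus × ↥mappingTorusPieceTwo))
    (hVS : fibreSliver (farSupport τ) ⊆ V) (hV1 : ∀ b ∈ V, b.1 ≠ 1)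
    (hVg : ∀ b ∈ V, sliverTwist (farDehn hτ hτ').symm b ∈ V)
    (G : ↥((prodTube S.monodromy S.prodRad S.prodRad_pos S.prodRad_le_pi S.monodromy_expT_of_norm_lt).localOpens
        (prodSliverCompl S.monodromy (isClosed_farSupport τ))) ≃ₘ⟮𝓡 4, 𝓡 4⟯
      ↥((prodTube S.monodromy S.prodRad S.prodRad_pos S.prodRad_le_pi S.monodromy_expT_of_norm_lt).localOpens
        (prodSliverCompl S.monodromy (isClosed_farSupport τ))))
    (hG : ∀ (x : ↥((prodTube S.monodromy S.prodRad S.prodRad_pos S.prodRad_le_pi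
        S.monodromy_expT_of_norm_lt).localOpens (prodSliverCompl S.monodromy (isClosed_farSupport τ))))
      (b : ↥V), (b : ThreeTorus × ↥mappingTorusPieceTwo) ∉ fibreSliver (farSupport τ) →
        (x : S.prodSphere) = (prodTube S.monodromy S.prodRad S.prodRad_pos S.prodRad_le_pi
          S.monodromy_expT_of_norm_lt).glueData.inl
          (opensToComplement (prodTube S.monodromy S.prodRad S.prodRad_pos S.prodRad_le_pi
            S.monodromy_expT_of_norm_lt) (mtGlueData S.monodromy).inr V
            (inr_not_mem_range_secCircle_self S.monodromy S.prodRad_pos S.prodRad_le_pi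
              S.monodromy_expT_of_norm_lt V hV1) b) →
          ∃ a' : ↥(prodTube S.monodromy S.prodRad S.prodRad_pos S.prodRad_le_pi
              S.monodromy_expT_of_norm_lt).complement,
            (a' : MTorus S.monodromy) = (mtGlueData S.monodromy).inr (sliverTwist (farDehn hτ hτ') b) ∧
              (G x : S.prodSphere) = (prodTube S.monodromy S.prodRad S.prodRad_pos S.prodRad_le_pi
                S.monodromy_expT_of_norm_lt).glueData.inl a') :
    Nonempty (gompfSphere B γ ≃ₘ⟮𝓡 4, 𝓡 4⟯ gompfSphere (gompfDelta ^ (1 : ℤ) * B) (γ.deltaLeft 1)) := by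
  have hgS : ∀ y ∉ farSupport τ, farDehn hτ hτ' y = y := fun y hy ↦ farDehn_eq_self hτ hτ' hy
  have hSε : ∀ v : 𝔼 3, ‖v‖ < S.prodRad → expT v ∉ farSupport τ := fun v hv ↦
    expT_not_mem_farSupport hτ (by
      have h1 : |v 1| ≤ ‖v‖ := (Real.norm_eq_abs _).symm.le.trans (PiLp.norm_apply_le v 1)
      linarith [S.prodRad_lt_pi_sub hτ'])
  have e1 := S.nonempty_diffeomorph_gompfSphere_prodSphere_of_homotopic γ hγ
  have e2 := nonempty_diffeomorph_prodSurgered_of_twistingDiffeo S.monodromy S.prodRad_pos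
    S.prodRad_le_pi S.monodromy_expT_of_norm_lt (farDehn hτ hτ') (isClosed_farSupport τ) hgS hSε V
    hVS hV1 hVg G hG
  have e3 := S.nonempty_diffeomorph_prodSurgered_trans_farDehn hτ hτ' S.prodRad_pos S.prodRad_le_pi
    (trans_apply_expT_of_norm_lt S.monodromy S.monodromy_expT_of_norm_lt (farDehn hτ hτ') hgS hSε) γ hγ
  exact nonempty_diffeomorph_trans e1 (nonempty_diffeomorph_trans e2 e3)

end Straightening

end Literature.Topology.FourManifolds
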